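import Summits.QuantumFields.YangMills.Theorems.UnitScaleTiltProp7OneFormGreenBlockDivergence
import Summits.QuantumFields.YangMills.Theorems.UnitScaleTiltProp7OneFormGradientSupNabla
import Summits.QuantumFields.YangMills.Theorems.UnitScaleTiltProp7GreenPiBlockLettersEdition
import HarnessLib

/-!
# Route `UnitScaleTilt`, crux K1 «MinimiserStabilityRegPr» (stmt-QuantumFields-19200), EX face, norm_G road — **(∇0): THE (115)-GRADIENT ROW OF `G₀`**, block edition (∇b) and
# sup edition (= the `hG0` letter of px17 g12's (∇1)-KNIT `…GreenOneGradientRowOfLetters`, token for token), at the (dκ) letters of ✓`Prop7OneFormGreenBlockDivergence`.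
Cell `ym3-torus` (HUMAN RULING D-0037; rung R3 = SU(2) YM₃ on T³ — NOT d = 4, NOT infinite volume, NOT a mass gap, NOT Clay).  Width seat `ym3-torus-px21` (gen 15).
THEOREMS ONLY (0 `def`, 0 `sorry`, default heartbeats); `--supports stmt-QuantumFields-19200 --as helper`; count-neutral.

WHY NOTHING NEW IS ANALYSED HERE.  ✓`Prop7OneFormGreenBlockDivergence.componentGradient_decay_of_rows` already bounds EVERY component covariant gradient of `G₀X`,
`‖toL2⁻¹(D_{U₀}(toL2S (G₀X)_ν)) b‖ ≤ M·e^{−κ₁·d(B b₋, z)}` (T1-core localised ✓`Prop7PoissonGradientDecay` + the (D)∕(Q) words + the local pair), and ✓(dκ)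
`norm_symm_DstarL2_GT_le_of_blockSupport` feeds it from the displayed letters before taking `D*` (factor `3e^{4κ₁}`).  (∇b) is the same feed stopped one step earlier; the
(115) currency is px5's dictionary ✓`Prop7OneFormGradientSupNabla.nabla115_bgOfCfg_eq_covGradT` + ✓`Prop7LandauDict.DL2_toL2S_eq_covDerivFwdT`; block ⟹ sup is ★p1's abstract
✓`Prop7GreenPiBlockLettersEdition.weighted_of_blockSupported` at weight rate `0` (coarse volume `(2(1+1∕κ₁))³`).

WHAT IS PROVED (ns `Summit.QuantumFields.YangMills.Theorems.Prop7OneFormGreenBlockGradient`; member `F n K`, `κ₁ := min r (1∕4) ∕ 2`; `G₀ = GT … (DeltaEtaSlot …) U₀`).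
DISPLAYED LETTERS = the (dκ) letters VERBATIM: `RegPr F n K ε₀ U₀` (`0 < ε₀ ≤ 1`), `PosOnto` at `DeltaEtaSlot`, (γ) `hco`, (C_V) `hVlow`, (θ_V-class) `hVconj`, the window `0 < Θ`,
the kernel rows `hkD` (`D(1−R_S)D*`), `hkQ` (`Q_k†(a•Q_k)`) at a rate `μ′ > r`, the decayed VALUE row `hval` (px16 (Gb), constant a free letter `A_V`), the no-wrap room, the gradient
margin `C_g·(48ε₀(6√2√10 + 6√2))·e^{51κ₁} ≤ ½`.
* §1 ★★ `norm_componentGradient_GT_le_of_blockSupport` — for `X` supported on the bonds of block `z` with `‖X b‖ ≤ s`: `∀ ν b, ‖toL2⁻¹(D_{U₀}(toL2S (G₀X)_ν)) b‖ ≤ s·C_∇·e^{−κ₁·d(B b₋, z)}`,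
  `C_∇ = C_D ∕ (3e^{4κ₁})` (the `M` of (dκ)'s docstring per unit `s`).
* §2 ★★★ `norm_nabla115_GT_apply_le_of_blockSupport` — the same in the (115) currency: `‖(nabla115 (eta F n K) (bgOfCfg F K U₀) (G₀X ∘ bondEquiv⁻¹)) (bondEquiv ⟨x, μ⟩, ν)‖ ≤ s·C_∇·e^{−κ₁·tdist(B x, z)}`;
  `norm_nabla115_GT_apply_le_of_blockSupport'` (at every lit bond `q`, located at `B (bondEquiv⁻¹ q)₋`, `η` spelled `((F.L:ℝ)⁻¹)^(K−n)`).
* §3 ★★★ `norm_nabla115_GT_le_of_sup` — **(∇0), THE SUP EDITION = px17 g12's `hG0` binder text**: for every `X` and `s` with `‖X b‖ ≤ s`,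
  `‖nabla115 (((F.L:ℝ)⁻¹)^(K−n)) (bgOfCfg F K U₀) (fun q => toL2⁻¹(G₀(toL2 X)) (bondEquiv⁻¹ q))‖ ≤ (C_∇·(2(1+1∕κ₁))³)·s` (no sign binder on `s`).
HYP-SAT (★★OWNER RULING №42): the letters are (dκ)'s — `RegPr` inhabited by EX's minimiser, `PosOnto`∕(γ) ⟸ ✓`hco_DeltaEtaSlot_exists`, (C_V)∕(θ_V) ⟸ ✓`hVlow_abs_of_lift`∕✓`hVconj_phaseClass_of_letters`,
`hkD` ⟸ the `h349` member text, `hkQ` ⟸ ✓`hkQ_of_regPr`, `hval` ⟸ px16 ✓`norm_symm_GT_apply_le_of_blockSupport`; non-vacuous (the K-free member edition inhabits the two windows).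
HONEST SCOPE.  Re-reading of landed analysis + bookkeeping; CONDITIONAL on every displayed letter; nothing of (∇1), `norm_G`, `h133`, the 8 EX rows, EX or the crux is proved here;
no summit is proved by a helper.
References: T. Bałaban, CMP **99** (1985) 389–434 [Balaban1985BackgroundPropagators] ((3.3) p.391, Thm 3.1 (3.42)–(3.44) pp.397–398, (3.47)–(3.49) pp.398–399, Thm 3.12 p.423);
CMP **102** (1985) 277–309 [Balaban1985Variational] ((19) p.281, (115)–(117) pp.294–295).
-/

set_option autoImplicit false

noncomputable section

open scoped BigOperators Matrix.Norms.L2Operator InnerProductSpace ComplexConjugate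

namespace Summit.QuantumFields.YangMills.Theorems.Prop7OneFormGreenBlockGradient

open Literature.MathematicalPhysics.QuantumFieldTheory.Balaban1983to89
open Literature.MathematicalPhysics.QuantumFieldTheory.Balaban1983to89.T3ContinuumYM3Torus
open Literature.MathematicalPhysics.QuantumFieldTheory.Balaban1983to89.T3PrintedRegularMinimiser (RegPr)
open T3SectALandauChart (formComp bgUnits covDerivFwdT covDivFormT eta eta_pos)
open B10Eq68TorusRegularity (covDerivT)
open B7Eq78Linearization (conjR conjR_apply conjR_sub conjR_smul_real)
open B7Prop1Explicit (U1)
open B4Sect5Torus (TSite)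
open B9SectCLatticeCarrier (Bond)
open B9TorusCalculus (torusT torusT_apply torusT_symm_apply)
open B9Eq310Hermitian (deltaPrimeOp)
open B11Eq135Weitzenbock (curvOp)
open B9Eq311L2Pairing (WL2)
open B11Eq103H1Complex (BondL2K SiteL2K)
open B5Eq118OneStroke (iterBlockOf)
open B3Taylor310LocalRemainder (tdist_comm tdist_triangle)
open Summit.QuantumFields.Balaban3D.Proofs.Run3Collar (tdist_shift_le)
open Summit.QuantumFields.YangMills.Theorems.Prop7SectET3Transport (periodsT3 siteEquiv bondEquiv)
open Summit.QuantumFields.YangMills.Theorems.Prop7SectET3HilbertLetters (W₂ frobEquiv toL2 toL2S DL2 DstarL2 covLapSite toL2_apply toL2_symm_apply toL2S_apply)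
open Summit.QuantumFields.YangMills.Theorems.Prop7LandauDict (DL2_toL2S_eq_covDerivFwdT DstarL2_toL2_eq_covDivFormT)
open Summit.QuantumFields.YangMills.Theorems.Prop7OneFormAgmonLocal (deltaPrimeOp_congr_of_agree curvOp_congr_of_agree tdist_le_two_of_stencil)
open Summit.QuantumFields.YangMills.Theorems.Prop7OneFormKatoForm (norm_local_remainder_le_of_regPr)
open Summit.QuantumFields.YangMills.Theorems.Prop7SectET3WilsonHessian (DeltaEta DeltaEtaSlot)
open Summit.QuantumFields.YangMills.Theorems.Prop7SectET3GaugeProjector (RS)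
open Summit.QuantumFields.YangMills.Theorems.Prop7SectET3CurvedPropagators (laplaceA Qk GT PosOnto laplaceA_GT)
open Summit.QuantumFields.YangMills.Theorems.Prop7RieszTauFrobNorm (norm_frobEquiv_le norm_frobEquiv_symm_le)
open Summit.QuantumFields.YangMills.Theorems.Prop7OneFormGreenSupBound (norm_toL2_blockPiece_le)
open Summit.QuantumFields.YangMills.Theorems.Prop7OneFormBlockDecayAll (blockDecay_allBlocks_of_letters eta_sq_exp_sub_one_sq_le)
open Summit.QuantumFields.YangMills.Theorems.Prop7OneFormRemainderDecay (norm_symm_apply_le_of_kernelRow_blockDecay)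
open Summit.QuantumFields.YangMills.Theorems.Prop7OneFormDecayData (norm_le_mul_exp_neg_of_support)
open Summit.QuantumFields.YangMills.Theorems.Prop7CurvedMemberLocalGradient (exists_curved_localGradient)
open Summit.QuantumFields.YangMills.Theorems.AxialGaugeChartGlue (norm_bgOfCfg_axialT_sub_le)
open Summit.QuantumFields.YangMills.Theorems.Prop7OneFormGreenBlockDivergenceLetters (norm_local_pair_le_of_decay blockL2Decay_GT_of_letters
  norm_word_le_of_kernelRow_blockDecay norm_symm_DstarL2_le_of_componentDecay)

open B11Eq111FrakG (nabla115)
open Summit.QuantumFields.YangMills.Theorems.Prop7SectET3Transport (bgOfCfg)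
open Summit.QuantumFields.YangMills.Theorems.Prop7OneFormGradientSupNabla (nabla115_bgOfCfg_eq_covGradT)
open Summit.QuantumFields.YangMills.Theorems.Prop7GreenPiBlockLettersEdition (weighted_of_blockSupported)
open Summit.QuantumFields.YangMills.Theorems.Prop7OneFormGreenBlockDivergence (componentGradient_decay_of_rows)

variable (F : T3Family) {n K : ℕ} (c₀ : ℝ) [Fact (0 < c₀)] (U₀ : GaugeField (F.P K) 0 (Matrix.specialUnitaryGroup (Fin 2) ℂ))
  {h : n ≤ K} {cB a : ℝ} [Fact (0 < cB)]

/-! ## §1 (∇b) in the component currency -/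

/-- ★★ **(∇b), COMPONENT CURRENCY: EVERY COMPONENT COVARIANT GRADIENT OF `G₀X` DECAYS OFF THE BLOCK OF THE SOURCE** — at the (dκ) letters, for `X` supported on the bonds of the block `z`
with `‖X b‖ ≤ s`: `‖toL2⁻¹(D_{U₀}(toL2S (G₀X)_ν)) b‖ ≤ s·C_∇·e^{−κ₁·d(B b₋, z)}` ([Balaban1985BackgroundPropagators] Thm 3.1 (3.42)₂ for the member's `G₀`, block∕decay edition; the feed of
✓`norm_symm_DstarL2_GT_le_of_blockSupport` into ✓`componentGradient_decay_of_rows`, verbatim, without the final divergence step).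
[cite: Balaban1985BackgroundPropagators, Thm 3.1 (3.42)–(3.44) pp.397–398, (3.46) p.398, (3.49) p.399, Thm 3.12 p.423; Balaban1985Variational, (19) p.281, (134)–(135) p.298] -/
theorem norm_componentGradient_GT_le_of_blockSupport (hnK : n ≤ K) {ε₀ : ℝ} (hε₀ : 0 < ε₀) (hε₀1 : ε₀ ≤ 1) (hreg : RegPr F n K ε₀ U₀)
    (hp : PosOnto F n K h c₀ cB a (DeltaEtaSlot F n K c₀) U₀)
    {r : ℝ} (hr : 0 < r) {γ CV θV ε : ℝ} (hε : 0 < ε) (hε1 : ε ≤ 1)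
    (hco : ∀ v : BondL2K ℂ 3 (periodsT3 F K) c₀ W₂, γ * ‖v‖ ^ 2 ≤ RCLike.re ⟪v, laplaceA F n K h c₀ cB a (DeltaEtaSlot F n K c₀) U₀ v⟫_ℂ)
    (hVlow : ∀ X : PBond (F.P K) 0 → Matrix (Fin 2) (Fin 2) ℂ,
      -(CV * ‖toL2 F K c₀ X‖ ^ 2) ≤ RCLike.re ⟪toL2 F K c₀ X, laplaceA F n K h c₀ cB a (DeltaEtaSlot F n K c₀) U₀ (toL2 F K c₀ X)⟫_ℂ
        - ∑ μ : Fin (F.P K).d, ‖DL2 F n K c₀ U₀ (toL2S F K c₀ (formComp X μ))‖ ^ 2)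
    (hVconj : ∀ φ : Site (F.P K) 0 → ℝ, (∀ x x' : Site (F.P K) 0, |φ x - φ x'| ≤ r * eta F n K * (Site.tdist x x' : ℝ)) →
      ∀ X : PBond (F.P K) 0 → Matrix (Fin 2) (Fin 2) ℂ,
      RCLike.re ⟪toL2 F K c₀ X, laplaceA F n K h c₀ cB a (DeltaEtaSlot F n K c₀) U₀ (toL2 F K c₀ X)⟫_ℂ
          - (∑ μ : Fin (F.P K).d, ‖DL2 F n K c₀ U₀ (toL2S F K c₀ (formComp X μ))‖ ^ 2) - θV * ‖toL2 F K c₀ X‖ ^ 2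
        ≤ RCLike.re ⟪toL2 F K c₀ (fun b => Real.exp (φ b.src) • X b), laplaceA F n K h c₀ cB a (DeltaEtaSlot F n K c₀) U₀ (toL2 F K c₀ (fun b => (Real.exp (φ b.src))⁻¹ • X b))⟫_ℂ
          - RCLike.re (∑ μ : Fin (F.P K).d, ⟪DL2 F n K c₀ U₀ (toL2S F K c₀ (formComp (fun b => Real.exp (φ b.src) • X b) μ)),
              DL2 F n K c₀ U₀ (toL2S F K c₀ (formComp (fun b => (Real.exp (φ b.src))⁻¹ • X b) μ))⟫_ℂ))
    (hΘ : 0 < ((1 - ε) * γ - ε * CV - 3 * (r ^ 2 * Real.exp (2 * r)) * (1 + 1 / ε) - θV))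
    {CkD CkQ μ' : ℝ} (hCkD : 0 ≤ CkD) (hCkQ : 0 ≤ CkQ) (hrμ : r < μ')
    (hkD : ∀ (b : PBond (F.P K) 0) (Z : Matrix (Fin 2) (Fin 2) ℂ) (bd : PBond (F.P K) 0),
      ‖(toL2 F K c₀).symm (DL2 F n K c₀ U₀ (DstarL2 F n K c₀ U₀ (toL2 F K c₀ (Pi.single b Z))
          - RS F n K h c₀ cB U₀ (DstarL2 F n K c₀ U₀ (toL2 F K c₀ (Pi.single b Z))))) bd‖
        ≤ CkD * Real.exp (-(μ' * (Site.tdist (P := F.P K) (iterBlockOf (K - n) b.src) (iterBlockOf (K - n) bd.src) : ℝ))) * ‖Z‖)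
    (hkQ : ∀ (b : PBond (F.P K) 0) (Z : Matrix (Fin 2) (Fin 2) ℂ) (bd : PBond (F.P K) 0),
      ‖(toL2 F K c₀).symm (LinearMap.adjoint (Qk F n K h c₀ cB U₀) (((a : ℝ) : ℂ) • Qk F n K h c₀ cB U₀ (toL2 F K c₀ (Pi.single b Z)))) bd‖
        ≤ CkQ * Real.exp (-(μ' * (Site.tdist (P := F.P K) (iterBlockOf (K - n) b.src) (iterBlockOf (K - n) bd.src) : ℝ))) * ‖Z‖)
    (X : PBond (F.P K) 0 → Matrix (Fin 2) (Fin 2) ℂ) (z : Site (F.P K) (K - n)) (hXz : ∀ b, X b ≠ 0 → iterBlockOf (K - n) b.src = z)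
    {s : ℝ} (hs : 0 ≤ s) (hX : ∀ b, ‖X b‖ ≤ s)
    {AV : ℝ}
    (hval : ∀ bd : PBond (F.P K) 0, ‖((toL2 F K c₀).symm (GT F n K h c₀ cB a (DeltaEtaSlot F n K c₀) U₀ (toL2 F K c₀ X))) bd‖ ≤ s * AV * Real.exp (-((min r (1 / 4) / 2) * (Site.tdist (P := F.P K) (iterBlockOf (K - n) bd.src) z : ℝ))))
    (hroom : 2 * (12 * F.L ^ (K - n) + 5) ≤ (F.P K).sitesPerDir 0)
    (hsmall : exists_curved_localGradient.choose * ((48 * ε₀) * (6 * Real.sqrt 2 * Real.sqrt 10 + 6 * Real.sqrt 2)) * Real.exp (51 * (min r (1 / 4) / 2)) ≤ 1 / 2)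
    (ν : Fin (F.P K).d) (b : PBond (F.P K) 0) :
    ‖(toL2 F K c₀).symm (DL2 F n K c₀ U₀ (toL2S F K c₀ (formComp ((toL2 F K c₀).symm (GT F n K h c₀ cB a (DeltaEtaSlot F n K c₀) U₀ (toL2 F K c₀ X))) ν))) b‖
      ≤ s * (2 * ((exists_curved_localGradient.choose * (((Real.sqrt 2 * AV) * Real.exp (51 * (min r (1 / 4) / 2))) * (2 + 2 * Real.sqrt 2 * (4 * ε₀ * (3 + 2457 * norm_bgOfCfg_axialT_sub_le.choose)) + (24 * Real.sqrt 10 + 48) * (48 * ε₀) ^ 2) + (Real.sqrt 2 * ((32 * ε₀ * (AV * Real.exp (5 * (min r (1 / 4) / 2)))) + (CkD * Real.sqrt ((((F.P K).d : ℝ) * ((((F.P K).L : ℝ) ^ (F.P K).d) ^ (K - n))) / c₀) * (Real.exp (6 * r) * Real.sqrt (2 * c₀ * (((F.P K).d : ℝ) * ((((F.P K).L : ℝ) ^ (F.P K).d) ^ (K - n)))) / ((1 - ε) * γ - ε * CV - 3 * (r ^ 2 * Real.exp (2 * r)) * (1 + 1 / ε) - θV)) * (2 * (1 + 1 / (μ'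 - r))) ^ 3) + (CkQ * Real.sqrt ((((F.P K).d : ℝ) * ((((F.P K).L : ℝ) ^ (F.P K).d) ^ (K - n))) / c₀) * (Real.exp (6 * r) * Real.sqrt (2 * c₀ * (((F.P K).d : ℝ) * ((((F.P K).L : ℝ) ^ (F.P K).d) ^ (K - n)))) / ((1 - ε) * γ - ε * CV - 3 * (r ^ 2 * Real.exp (2 * r)) * (1 + 1 / ε) - θV)) * (2 * (1 + 1 / (μ' - r))) ^ 3) + 1)) * Real.exp (51 * (min r (1 / 4) / 2))) + 2 * Real.sqrt 2 * (48 * ε₀) * ((Real.sqrt 2 * AV) * Real.exp (51 * (min r (1 / 4) / 2)))))) * Real.exp (-((min r (1 / 4) / 2) * (Site.tdist (P := F.P K) (iterBlockOf (K - n) b.src) z : ℝ))) := by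
  -- one site to read `0 ≤ s·A_V` off the value row
  obtain ⟨x⟩ : Nonempty (Site (F.P K) 0) := ⟨b.src⟩

  have hc₀ : 0 < c₀ := Fact.out
  have hk1 : 0 < (min r (1 / 4) / 2) := by have := lt_min hr (by norm_num : (0 : ℝ) < 1 / 4); positivity
  have hk1r : (min r (1 / 4) / 2) ≤ r := by have := min_le_left r (1 / 4); linarith
  have hD₁0 : 0 ≤ (Real.exp (6 * r) * Real.sqrt (2 * c₀ * (((F.P K).d : ℝ) * ((((F.P K).L : ℝ) ^ (F.P K).d) ^ (K - n)))) / ((1 - ε) * γ - ε * CV - 3 * (r ^ 2 * Real.exp (2 * r)) * (1 + 1 / ε) - θV)) := div_nonneg (by positivity) hΘ.le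
  have hS0 : 0 ≤ (2 * (1 + 1 / (μ' - r))) ^ 3 := by
    have : 0 < μ' - r := by linarith
    positivity
  -- rate `r` rows read at rate `κ₁ ≤ r`
  have hEr : ∀ b : PBond (F.P K) 0, Real.exp (-(r * (Site.tdist (P := F.P K) (iterBlockOf (K - n) b.src) z : ℝ))) ≤ Real.exp (-((min r (1 / 4) / 2) * (Site.tdist (P := F.P K) (iterBlockOf (K - n) b.src) z : ℝ))) := fun b =>
    Real.exp_le_exp.2 (by nlinarith [Nat.cast_nonneg (α := ℝ) (Site.tdist (P := F.P K) (iterBlockOf (K - n) b.src) z)])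
  -- VALUE
  have hWd : ∀ b : PBond (F.P K) 0, ‖((toL2 F K c₀).symm (GT F n K h c₀ cB a (DeltaEtaSlot F n K c₀) U₀ (toL2 F K c₀ X))) b‖ ≤ (s * AV) * Real.exp (-((min r (1 / 4) / 2) * (Site.tdist (P := F.P K) (iterBlockOf (K - n) b.src) z : ℝ))) := fun b => hval b
  -- `0 ≤ s·A_V` is READ OFF the value row at one bond (no sign hypothesis on `A_V` displayed)
  have hsAV : 0 ≤ s * AV := by
    have hb := hval ⟨x, ⟨0, by rw [T3Family.P_d]; norm_num⟩⟩
    have hE : 0 < Real.exp (-((min r (1 / 4) / 2) * (Site.tdist (P := F.P K) (iterBlockOf (K - n) (⟨x, ⟨0, by rw [T3Family.P_d]; norm_num⟩⟩ : PBond (F.P K) 0).src) z : ℝ))) :=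
      Real.exp_pos _
    have h0 : 0 * Real.exp (-((min r (1 / 4) / 2) * (Site.tdist (P := F.P K) (iterBlockOf (K - n) (⟨x, ⟨0, by rw [T3Family.P_d]; norm_num⟩⟩ : PBond (F.P K) 0).src) z : ℝ)))
        ≤ (s * AV) * Real.exp (-((min r (1 / 4) / 2) * (Site.tdist (P := F.P K) (iterBlockOf (K - n) (⟨x, ⟨0, by rw [T3Family.P_d]; norm_num⟩⟩ : PBond (F.P K) 0).src) z : ℝ))) := by
      rw [zero_mul]; exact (norm_nonneg _).trans hb
    exact le_of_mul_le_mul_right h0 hE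
  have hWeq : toL2 F K c₀ ((toL2 F K c₀).symm (GT F n K h c₀ cB a (DeltaEtaSlot F n K c₀) U₀ (toL2 F K c₀ X))) = GT F n K h c₀ cB a (DeltaEtaSlot F n K c₀) U₀ (toL2 F K c₀ X) := LinearEquiv.apply_symm_apply _ _
  -- the block-`L²` decay and the two words
  have hD := blockL2Decay_GT_of_letters F c₀ U₀ hnK hp hr hε hε1 hco hVlow hVconj hΘ X z hXz hs hX
  have hkD' : ∀ (b : PBond (F.P K) 0) (Z : Matrix (Fin 2) (Fin 2) ℂ) (bd : PBond (F.P K) 0),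
      ‖(toL2 F K c₀).symm ((DL2 F n K c₀ U₀ ∘ₗ (DstarL2 F n K c₀ U₀ - RS F n K h c₀ cB U₀ ∘ₗ DstarL2 F n K c₀ U₀)) (toL2 F K c₀ (Pi.single b Z))) bd‖
        ≤ CkD * Real.exp (-(μ' * (Site.tdist (P := F.P K) (iterBlockOf (K - n) b.src) (iterBlockOf (K - n) bd.src) : ℝ))) * ‖Z‖ := fun b Z bd => hkD b Z bd
  have hkQ' : ∀ (b : PBond (F.P K) 0) (Z : Matrix (Fin 2) (Fin 2) ℂ) (bd : PBond (F.P K) 0),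
      ‖(toL2 F K c₀).symm ((LinearMap.adjoint (Qk F n K h c₀ cB U₀) ∘ₗ (((a : ℝ) : ℂ) • Qk F n K h c₀ cB U₀)) (toL2 F K c₀ (Pi.single b Z))) bd‖
        ≤ CkQ * Real.exp (-(μ' * (Site.tdist (P := F.P K) (iterBlockOf (K - n) b.src) (iterBlockOf (K - n) bd.src) : ℝ))) * ‖Z‖ := fun b Z bd => hkQ b Z bd
  have hDword : ∀ bd : PBond (F.P K) 0, ‖(toL2 F K c₀).symm (DL2 F n K c₀ U₀ (DstarL2 F n K c₀ U₀ (toL2 F K c₀ ((toL2 F K c₀).symm (GT F n K h c₀ cB a (DeltaEtaSlot F n K c₀) U₀ (toL2 F K c₀ X)))) - RS F n K h c₀ cB U₀ (DstarL2 F n K c₀ U₀ (toL2 F K c₀ ((toL2 F K c₀).symm (GT F n K h c₀ cB a (DeltaEtaSlot F n K c₀) U₀ (toL2 F K c₀ X))))))) bd‖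
      ≤ (CkD * Real.sqrt ((((F.P K).d : ℝ) * ((((F.P K).L : ℝ) ^ (F.P K).d) ^ (K - n))) / c₀) * ((Real.exp (6 * r) * Real.sqrt (2 * c₀ * (((F.P K).d : ℝ) * ((((F.P K).L : ℝ) ^ (F.P K).d) ^ (K - n)))) / ((1 - ε) * γ - ε * CV - 3 * (r ^ 2 * Real.exp (2 * r)) * (1 + 1 / ε) - θV)) * s) * (2 * (1 + 1 / (μ' - r))) ^ 3) * Real.exp (-((min r (1 / 4) / 2) * (Site.tdist (P := F.P K) (iterBlockOf (K - n) bd.src) z : ℝ))) := by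
    intro bd
    have h1 := norm_word_le_of_kernelRow_blockDecay F c₀ _ hCkD hkD' _ z (mul_nonneg hD₁0 hs) hr.le hrμ hD bd
    rw [hWeq]
    exact h1.trans (mul_le_mul_of_nonneg_left (hEr bd) (mul_nonneg (mul_nonneg (mul_nonneg hCkD (Real.sqrt_nonneg _)) (mul_nonneg hD₁0 hs)) hS0))
  have hQword : ∀ bd : PBond (F.P K) 0, ‖(toL2 F K c₀).symm (LinearMap.adjoint (Qk F n K h c₀ cB U₀) (((a : ℝ) : ℂ) • Qk F n K h c₀ cB U₀ (toL2 F K c₀ ((toL2 F K c₀).symm (GT F n K h c₀ cB a (DeltaEtaSlot F n K c₀) U₀ (toL2 F K c₀ X)))))) bd‖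
      ≤ (CkQ * Real.sqrt ((((F.P K).d : ℝ) * ((((F.P K).L : ℝ) ^ (F.P K).d) ^ (K - n))) / c₀) * ((Real.exp (6 * r) * Real.sqrt (2 * c₀ * (((F.P K).d : ℝ) * ((((F.P K).L : ℝ) ^ (F.P K).d) ^ (K - n)))) / ((1 - ε) * γ - ε * CV - 3 * (r ^ 2 * Real.exp (2 * r)) * (1 + 1 / ε) - θV)) * s) * (2 * (1 + 1 / (μ' - r))) ^ 3) * Real.exp (-((min r (1 / 4) / 2) * (Site.tdist (P := F.P K) (iterBlockOf (K - n) bd.src) z : ℝ))) := by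
    intro bd
    have h1 := norm_word_le_of_kernelRow_blockDecay F c₀ _ hCkQ hkQ' _ z (mul_nonneg hD₁0 hs) hr.le hrμ hD bd
    rw [hWeq]
    exact h1.trans (mul_le_mul_of_nonneg_left (hEr bd) (mul_nonneg (mul_nonneg (mul_nonneg hCkQ (Real.sqrt_nonneg _)) (mul_nonneg hD₁0 hs)) hS0))
  -- LOCAL pair and SOURCE
  have hLoc := norm_local_pair_le_of_decay F U₀ hreg ((toL2 F K c₀).symm (GT F n K h c₀ cB a (DeltaEtaSlot F n K c₀) U₀ (toL2 F K c₀ X))) z hk1.le hsAV hWd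
  have hSrc : ∀ b : PBond (F.P K) 0, ‖X b‖ ≤ s * Real.exp (-((min r (1 / 4) / 2) * (Site.tdist (P := F.P K) (iterBlockOf (K - n) b.src) z : ℝ))) := fun b =>
    norm_le_mul_exp_neg_of_support X (fun b => (Site.tdist (P := F.P K) (iterBlockOf (K - n) b.src) z : ℝ)) (min r (1 / 4) / 2) hX
      (fun b hb => by rw [hXz b hb]; exact_mod_cast B3Taylor310LocalRemainder.tdist_self z) b
  -- the components' gradients
  have hgrad := componentGradient_decay_of_rows F c₀ U₀ (h := h) (cB := cB) (a := a) hε₀ hε₀1 hreg hp X z hk1.le hsAV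
    (mul_nonneg (by positivity) (mul_nonneg hsAV (Real.exp_pos _).le) : 0 ≤ 32 * ε₀ * ((s * AV) * Real.exp (5 * (min r (1 / 4) / 2))))
    (mul_nonneg (mul_nonneg (mul_nonneg hCkD (Real.sqrt_nonneg _)) (mul_nonneg hD₁0 hs)) hS0)
    (mul_nonneg (mul_nonneg (mul_nonneg hCkQ (Real.sqrt_nonneg _)) (mul_nonneg hD₁0 hs)) hS0) hs
    hWd (fun b => (hLoc b).trans_eq (by ring)) hDword hQword hSrc hroom hsmall
  refine (hgrad ν b).trans (le_of_eq ?_)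
  ring

/-! ## §2 (∇b) in the (115) currency -/

/-- ★★★ **(∇b) IN THE (115) CURRENCY**: `‖(nabla115 (eta F n K) (bgOfCfg F K U₀) (G₀X ∘ bondEquiv⁻¹)) (bondEquiv ⟨x, μ⟩, ν)‖ ≤ s·C_∇·e^{−κ₁·tdist(B x, z)}` — §1 read through px5's dictionary
✓`nabla115_bgOfCfg_eq_covGradT` ([Balaban1985BackgroundPropagators] (3.3) = [Balaban1985Variational] (19)) and ✓`DL2_toL2S_eq_covDerivFwdT`.
[cite: Balaban1985BackgroundPropagators, (3.3) p.391, Thm 3.1 (3.42) p.397, Thm 3.12 p.423; Balaban1985Variational, (19) p.281, (115) p.294] -/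
theorem norm_nabla115_GT_apply_le_of_blockSupport (hnK : n ≤ K) {ε₀ : ℝ} (hε₀ : 0 < ε₀) (hε₀1 : ε₀ ≤ 1) (hreg : RegPr F n K ε₀ U₀)
    (hp : PosOnto F n K h c₀ cB a (DeltaEtaSlot F n K c₀) U₀)
    {r : ℝ} (hr : 0 < r) {γ CV θV ε : ℝ} (hε : 0 < ε) (hε1 : ε ≤ 1)
    (hco : ∀ v : BondL2K ℂ 3 (periodsT3 F K) c₀ W₂, γ * ‖v‖ ^ 2 ≤ RCLike.re ⟪v, laplaceA F n K h c₀ cB a (DeltaEtaSlot F n K c₀) U₀ v⟫_ℂ)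
    (hVlow : ∀ X : PBond (F.P K) 0 → Matrix (Fin 2) (Fin 2) ℂ,
      -(CV * ‖toL2 F K c₀ X‖ ^ 2) ≤ RCLike.re ⟪toL2 F K c₀ X, laplaceA F n K h c₀ cB a (DeltaEtaSlot F n K c₀) U₀ (toL2 F K c₀ X)⟫_ℂ
        - ∑ μ : Fin (F.P K).d, ‖DL2 F n K c₀ U₀ (toL2S F K c₀ (formComp X μ))‖ ^ 2)
    (hVconj : ∀ φ : Site (F.P K) 0 → ℝ, (∀ x x' : Site (F.P K) 0, |φ x - φ x'| ≤ r * eta F n K * (Site.tdist x x' : ℝ)) →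
      ∀ X : PBond (F.P K) 0 → Matrix (Fin 2) (Fin 2) ℂ,
      RCLike.re ⟪toL2 F K c₀ X, laplaceA F n K h c₀ cB a (DeltaEtaSlot F n K c₀) U₀ (toL2 F K c₀ X)⟫_ℂ
          - (∑ μ : Fin (F.P K).d, ‖DL2 F n K c₀ U₀ (toL2S F K c₀ (formComp X μ))‖ ^ 2) - θV * ‖toL2 F K c₀ X‖ ^ 2
        ≤ RCLike.re ⟪toL2 F K c₀ (fun b => Real.exp (φ b.src) • X b), laplaceA F n K h c₀ cB a (DeltaEtaSlot F n K c₀) U₀ (toL2 F K c₀ (fun b => (Real.exp (φ b.src))⁻¹ • X b))⟫_ℂ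
          - RCLike.re (∑ μ : Fin (F.P K).d, ⟪DL2 F n K c₀ U₀ (toL2S F K c₀ (formComp (fun b => Real.exp (φ b.src) • X b) μ)),
              DL2 F n K c₀ U₀ (toL2S F K c₀ (formComp (fun b => (Real.exp (φ b.src))⁻¹ • X b) μ))⟫_ℂ))
    (hΘ : 0 < ((1 - ε) * γ - ε * CV - 3 * (r ^ 2 * Real.exp (2 * r)) * (1 + 1 / ε) - θV))
    {CkD CkQ μ' : ℝ} (hCkD : 0 ≤ CkD) (hCkQ : 0 ≤ CkQ) (hrμ : r < μ')
    (hkD : ∀ (b : PBond (F.P K) 0) (Z : Matrix (Fin 2) (Fin 2) ℂ) (bd : PBond (F.P K) 0),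
      ‖(toL2 F K c₀).symm (DL2 F n K c₀ U₀ (DstarL2 F n K c₀ U₀ (toL2 F K c₀ (Pi.single b Z))
          - RS F n K h c₀ cB U₀ (DstarL2 F n K c₀ U₀ (toL2 F K c₀ (Pi.single b Z))))) bd‖
        ≤ CkD * Real.exp (-(μ' * (Site.tdist (P := F.P K) (iterBlockOf (K - n) b.src) (iterBlockOf (K - n) bd.src) : ℝ))) * ‖Z‖)
    (hkQ : ∀ (b : PBond (F.P K) 0) (Z : Matrix (Fin 2) (Fin 2) ℂ) (bd : PBond (F.P K) 0),
      ‖(toL2 F K c₀).symm (LinearMap.adjoint (Qk F n K h c₀ cB U₀) (((a : ℝ) : ℂ) • Qk F n K h c₀ cB U₀ (toL2 F K c₀ (Pi.single b Z)))) bd‖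
        ≤ CkQ * Real.exp (-(μ' * (Site.tdist (P := F.P K) (iterBlockOf (K - n) b.src) (iterBlockOf (K - n) bd.src) : ℝ))) * ‖Z‖)
    (X : PBond (F.P K) 0 → Matrix (Fin 2) (Fin 2) ℂ) (z : Site (F.P K) (K - n)) (hXz : ∀ b, X b ≠ 0 → iterBlockOf (K - n) b.src = z)
    {s : ℝ} (hs : 0 ≤ s) (hX : ∀ b, ‖X b‖ ≤ s)
    {AV : ℝ}
    (hval : ∀ bd : PBond (F.P K) 0, ‖((toL2 F K c₀).symm (GT F n K h c₀ cB a (DeltaEtaSlot F n K c₀) U₀ (toL2 F K c₀ X))) bd‖ ≤ s * AV * Real.exp (-((min r (1 / 4) / 2) * (Site.tdist (P := F.P K) (iterBlockOf (K - n) bd.src) z : ℝ))))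
    (hroom : 2 * (12 * F.L ^ (K - n) + 5) ≤ (F.P K).sitesPerDir 0)
    (hsmall : exists_curved_localGradient.choose * ((48 * ε₀) * (6 * Real.sqrt 2 * Real.sqrt 10 + 6 * Real.sqrt 2)) * Real.exp (51 * (min r (1 / 4) / 2)) ≤ 1 / 2)
    (x : Site (F.P K) 0) (μ ν : Fin 3) :
    ‖nabla115 (eta F n K) (bgOfCfg F K U₀) (fun q : Bond 3 (periodsT3 F K) => ((toL2 F K c₀).symm (GT F n K h c₀ cB a (DeltaEtaSlot F n K c₀) U₀ (toL2 F K c₀ X))) ((bondEquiv F K).symm q)) (bondEquiv F K ⟨x, μ⟩, ν)‖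
      ≤ s * (2 * ((exists_curved_localGradient.choose * (((Real.sqrt 2 * AV) * Real.exp (51 * (min r (1 / 4) / 2))) * (2 + 2 * Real.sqrt 2 * (4 * ε₀ * (3 + 2457 * norm_bgOfCfg_axialT_sub_le.choose)) + (24 * Real.sqrt 10 + 48) * (48 * ε₀) ^ 2) + (Real.sqrt 2 * ((32 * ε₀ * (AV * Real.exp (5 * (min r (1 / 4) / 2)))) + (CkD * Real.sqrt ((((F.P K).d : ℝ) * ((((F.P K).L : ℝ) ^ (F.P K).d) ^ (K - n))) / c₀) * (Real.exp (6 * r) * Real.sqrt (2 * c₀ * (((F.P K).d : ℝ) * ((((F.P K).L : ℝ) ^ (F.P K).d) ^ (K - n)))) / ((1 - ε) * γ - ε * CV - 3 * (r ^ 2 * Real.exp (2 * r)) * (1 + 1 / ε) - θV)) * (2 * (1 + 1 / (μ' - r))) ^ 3) + (CkQ * Real.sqrt ((((F.P K).d : ℝ) * ((((F.P K).L : ℝ) ^ (F.P K).d) ^ (K - n))) / c₀) * (Real.exp (6 * r) * Real.sqrt (2 * c₀ * (((F.P K).d : ℝ) * ((((F.P K).L : ℝ) ^ (F.P K).d) ^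 (K - n)))) / ((1 - ε) * γ - ε * CV - 3 * (r ^ 2 * Real.exp (2 * r)) * (1 + 1 / ε) - θV)) * (2 * (1 + 1 / (μ' - r))) ^ 3) + 1)) * Real.exp (51 * (min r (1 / 4) / 2))) + 2 * Real.sqrt 2 * (48 * ε₀) * ((Real.sqrt 2 * AV) * Real.exp (51 * (min r (1 / 4) / 2)))))) * Real.exp (-((min r (1 / 4) / 2) * (Site.tdist (P := F.P K) (iterBlockOf (K - n) x) z : ℝ))) := by
  rw [nabla115_bgOfCfg_eq_covGradT F c₀ U₀]
  have hroute : T3SectALandauChart.covGradT (eta F n K) (bgUnits F K U₀) ((toL2 F K c₀).symm (GT F n K h c₀ cB a (DeltaEtaSlot F n K c₀) U₀ (toL2 F K c₀ X))) μ ν x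
      = (toL2 F K c₀).symm (DL2 F n K c₀ U₀ (toL2S F K c₀ (formComp ((toL2 F K c₀).symm (GT F n K h c₀ cB a (DeltaEtaSlot F n K c₀) U₀ (toL2 F K c₀ X))) ν))) ⟨x, μ⟩ := by
    rw [DL2_toL2S_eq_covDerivFwdT]; rfl
  rw [hroute]
  exact norm_componentGradient_GT_le_of_blockSupport F c₀ U₀ hnK hε₀ hε₀1 hreg hp hr hε hε1 hco hVlow hVconj hΘ hCkD hCkQ hrμ hkD hkQ X z hXz hs hX hval hroom hsmall ν ⟨x, μ⟩

/-- ★★ The same AT EVERY LIT BOND `q` (located at the block of `(bondEquiv⁻¹ q)₋`), with `η` spelled `((F.L:ℝ)⁻¹)^(K−n)` as the EX face and px17's `hG0` do (`eta F n K` is that term).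
[cite: Balaban1985BackgroundPropagators, (3.3) p.391, Thm 3.1 (3.42) p.397; Balaban1985Variational, (5) p.278, (115) p.294] -/
theorem norm_nabla115_GT_apply_le_of_blockSupport' (hnK : n ≤ K) {ε₀ : ℝ} (hε₀ : 0 < ε₀) (hε₀1 : ε₀ ≤ 1) (hreg : RegPr F n K ε₀ U₀)
    (hp : PosOnto F n K h c₀ cB a (DeltaEtaSlot F n K c₀) U₀)
    {r : ℝ} (hr : 0 < r) {γ CV θV ε : ℝ} (hε : 0 < ε) (hε1 : ε ≤ 1)
    (hco : ∀ v : BondL2K ℂ 3 (periodsT3 F K) c₀ W₂, γ * ‖v‖ ^ 2 ≤ RCLike.re ⟪v, laplaceA F n K h c₀ cB a (DeltaEtaSlot F n K c₀) U₀ v⟫_ℂ)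
    (hVlow : ∀ X : PBond (F.P K) 0 → Matrix (Fin 2) (Fin 2) ℂ,
      -(CV * ‖toL2 F K c₀ X‖ ^ 2) ≤ RCLike.re ⟪toL2 F K c₀ X, laplaceA F n K h c₀ cB a (DeltaEtaSlot F n K c₀) U₀ (toL2 F K c₀ X)⟫_ℂ
        - ∑ μ : Fin (F.P K).d, ‖DL2 F n K c₀ U₀ (toL2S F K c₀ (formComp X μ))‖ ^ 2)
    (hVconj : ∀ φ : Site (F.P K) 0 → ℝ, (∀ x x' : Site (F.P K) 0, |φ x - φ x'| ≤ r * eta F n K * (Site.tdist x x' : ℝ)) →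
      ∀ X : PBond (F.P K) 0 → Matrix (Fin 2) (Fin 2) ℂ,
      RCLike.re ⟪toL2 F K c₀ X, laplaceA F n K h c₀ cB a (DeltaEtaSlot F n K c₀) U₀ (toL2 F K c₀ X)⟫_ℂ
          - (∑ μ : Fin (F.P K).d, ‖DL2 F n K c₀ U₀ (toL2S F K c₀ (formComp X μ))‖ ^ 2) - θV * ‖toL2 F K c₀ X‖ ^ 2
        ≤ RCLike.re ⟪toL2 F K c₀ (fun b => Real.exp (φ b.src) • X b), laplaceA F n K h c₀ cB a (DeltaEtaSlot F n K c₀) U₀ (toL2 F K c₀ (fun b => (Real.exp (φ b.src))⁻¹ • X b))⟫_ℂ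
          - RCLike.re (∑ μ : Fin (F.P K).d, ⟪DL2 F n K c₀ U₀ (toL2S F K c₀ (formComp (fun b => Real.exp (φ b.src) • X b) μ)),
              DL2 F n K c₀ U₀ (toL2S F K c₀ (formComp (fun b => (Real.exp (φ b.src))⁻¹ • X b) μ))⟫_ℂ))
    (hΘ : 0 < ((1 - ε) * γ - ε * CV - 3 * (r ^ 2 * Real.exp (2 * r)) * (1 + 1 / ε) - θV))
    {CkD CkQ μ' : ℝ} (hCkD : 0 ≤ CkD) (hCkQ : 0 ≤ CkQ) (hrμ : r < μ')
    (hkD : ∀ (b : PBond (F.P K) 0) (Z : Matrix (Fin 2) (Fin 2) ℂ) (bd : PBond (F.P K) 0),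
      ‖(toL2 F K c₀).symm (DL2 F n K c₀ U₀ (DstarL2 F n K c₀ U₀ (toL2 F K c₀ (Pi.single b Z))
          - RS F n K h c₀ cB U₀ (DstarL2 F n K c₀ U₀ (toL2 F K c₀ (Pi.single b Z))))) bd‖
        ≤ CkD * Real.exp (-(μ' * (Site.tdist (P := F.P K) (iterBlockOf (K - n) b.src) (iterBlockOf (K - n) bd.src) : ℝ))) * ‖Z‖)
    (hkQ : ∀ (b : PBond (F.P K) 0) (Z : Matrix (Fin 2) (Fin 2) ℂ) (bd : PBond (F.P K) 0),
      ‖(toL2 F K c₀).symm (LinearMap.adjoint (Qk F n K h c₀ cB U₀) (((a : ℝ) : ℂ) • Qk F n K h c₀ cB U₀ (toL2 F K c₀ (Pi.single b Z)))) bd‖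
        ≤ CkQ * Real.exp (-(μ' * (Site.tdist (P := F.P K) (iterBlockOf (K - n) b.src) (iterBlockOf (K - n) bd.src) : ℝ))) * ‖Z‖)
    (X : PBond (F.P K) 0 → Matrix (Fin 2) (Fin 2) ℂ) (z : Site (F.P K) (K - n)) (hXz : ∀ b, X b ≠ 0 → iterBlockOf (K - n) b.src = z)
    {s : ℝ} (hs : 0 ≤ s) (hX : ∀ b, ‖X b‖ ≤ s)
    {AV : ℝ}
    (hval : ∀ bd : PBond (F.P K) 0, ‖((toL2 F K c₀).symm (GT F n K h c₀ cB a (DeltaEtaSlot F n K c₀) U₀ (toL2 F K c₀ X))) bd‖ ≤ s * AV * Real.exp (-((min r (1 / 4) / 2) * (Site.tdist (P := F.P K) (iterBlockOf (K - n) bd.src) z : ℝ))))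
    (hroom : 2 * (12 * F.L ^ (K - n) + 5) ≤ (F.P K).sitesPerDir 0)
    (hsmall : exists_curved_localGradient.choose * ((48 * ε₀) * (6 * Real.sqrt 2 * Real.sqrt 10 + 6 * Real.sqrt 2)) * Real.exp (51 * (min r (1 / 4) / 2)) ≤ 1 / 2)
    (q : Bond 3 (periodsT3 F K)) (ν : Fin 3) :
    ‖nabla115 (((F.L : ℝ)⁻¹) ^ (K - n)) (bgOfCfg F K U₀) (fun q : Bond 3 (periodsT3 F K) => ((toL2 F K c₀).symm (GT F n K h c₀ cB a (DeltaEtaSlot F n K c₀) U₀ (toL2 F K c₀ X))) ((bondEquiv F K).symm q)) (q, ν)‖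
      ≤ s * (2 * ((exists_curved_localGradient.choose * (((Real.sqrt 2 * AV) * Real.exp (51 * (min r (1 / 4) / 2))) * (2 + 2 * Real.sqrt 2 * (4 * ε₀ * (3 + 2457 * norm_bgOfCfg_axialT_sub_le.choose)) + (24 * Real.sqrt 10 + 48) * (48 * ε₀) ^ 2) + (Real.sqrt 2 * ((32 * ε₀ * (AV * Real.exp (5 * (min r (1 / 4) / 2)))) + (CkD * Real.sqrt ((((F.P K).d : ℝ) * ((((F.P K).L : ℝ) ^ (F.P K).d) ^ (K - n))) / c₀) * (Real.exp (6 * r) * Real.sqrt (2 * c₀ * (((F.P K).d : ℝ) * ((((F.P K).L : ℝ) ^ (F.P K).d) ^ (K - n)))) / ((1 - ε) * γ - ε * CV - 3 * (r ^ 2 * Real.exp (2 * r)) * (1 + 1 / ε) - θV)) * (2 * (1 + 1 / (μ' - r))) ^ 3) + (CkQ * Real.sqrt ((((F.P K).d : ℝ) * ((((F.P K).L : ℝ) ^ (F.P K).d) ^ (K - n))) / c₀) * (Real.exp (6 * r) * Real.sqrt (2 * c₀ * (((F.P K).d : ℝ) * ((((F.P K).L : ℝ) ^ (F.P K).d) ^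 (K - n)))) / ((1 - ε) * γ - ε * CV - 3 * (r ^ 2 * Real.exp (2 * r)) * (1 + 1 / ε) - θV)) * (2 * (1 + 1 / (μ' - r))) ^ 3) + 1)) * Real.exp (51 * (min r (1 / 4) / 2))) + 2 * Real.sqrt 2 * (48 * ε₀) * ((Real.sqrt 2 * AV) * Real.exp (51 * (min r (1 / 4) / 2)))))) * Real.exp (-((min r (1 / 4) / 2) * (Site.tdist (P := F.P K) (iterBlockOf (K - n) ((bondEquiv F K).symm q).src) z : ℝ))) := by
  obtain ⟨⟨x, μ⟩, rfl⟩ := (bondEquiv F K).surjective q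
  rw [Equiv.symm_apply_apply]
  exact norm_nabla115_GT_apply_le_of_blockSupport F c₀ U₀ hnK hε₀ hε₀1 hreg hp hr hε hε1 hco hVlow hVconj hΘ hCkD hCkQ hrμ hkD hkQ X z hXz hs hX hval hroom hsmall x μ ν

/-! ## §3 (∇0): the sup edition = px17 g12's `hG0` letter -/

/-- ★★★ **(∇0), THE (115)-GRADIENT ROW OF `G₀` ON SUP-BOUNDED SOURCES** — at the (dκ) letters with the decayed VALUE row now quantified over block-supported sources (`hvalb` = px16
✓`Prop7OneFormGreenSupBound.norm_symm_GT_apply_le_of_blockSupport`'s conclusion, binders `X z hXz s hs hX bd`): for EVERY bond field `X` with `‖X b‖ ≤ s`,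
`‖nabla115 (((F.L:ℝ)⁻¹)^(K−n)) (bgOfCfg F K U₀) (fun q => toL2⁻¹(G₀(toL2 X)) (bondEquiv⁻¹ q))‖ ≤ (C_∇·(2(1+1∕κ₁))³)·s` — the `hG0` binder of px17 g12's (∇1)-KNIT
`Prop7GreenOneGradientRowOfLetters.gradient_row_GTone_of_letters` TOKEN FOR TOKEN ([Balaban1985BackgroundPropagators] Thm 3.3 (3.47)₂ `|∇G f| ≤ B|f|` for the member's `G₀`, sup currency).
PROOF: block pieces of `X`, §2 per piece, the coarse volume — ★p1's ✓`weighted_of_blockSupported` at weight rate `0` for the block-additive reader `X ↦ ∇_{U₀}(G₀X ∘ bE⁻¹)`; then the Pi sup norm.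
[cite: Balaban1985BackgroundPropagators, Thm 3.3 (3.47)–(3.48) p.398, (3.49) p.399, Thm 3.1 (3.42) p.397, Thm 3.12 p.423; Balaban1985Variational, (19) p.281, (115)–(117) pp.294–295] -/
theorem norm_nabla115_GT_le_of_sup (hnK : n ≤ K) {ε₀ : ℝ} (hε₀ : 0 < ε₀) (hε₀1 : ε₀ ≤ 1) (hreg : RegPr F n K ε₀ U₀)
    (hp : PosOnto F n K h c₀ cB a (DeltaEtaSlot F n K c₀) U₀)
    {r : ℝ} (hr : 0 < r) {γ CV θV ε : ℝ} (hε : 0 < ε) (hε1 : ε ≤ 1)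
    (hco : ∀ v : BondL2K ℂ 3 (periodsT3 F K) c₀ W₂, γ * ‖v‖ ^ 2 ≤ RCLike.re ⟪v, laplaceA F n K h c₀ cB a (DeltaEtaSlot F n K c₀) U₀ v⟫_ℂ)
    (hVlow : ∀ X : PBond (F.P K) 0 → Matrix (Fin 2) (Fin 2) ℂ,
      -(CV * ‖toL2 F K c₀ X‖ ^ 2) ≤ RCLike.re ⟪toL2 F K c₀ X, laplaceA F n K h c₀ cB a (DeltaEtaSlot F n K c₀) U₀ (toL2 F K c₀ X)⟫_ℂ
        - ∑ μ : Fin (F.P K).d, ‖DL2 F n K c₀ U₀ (toL2S F K c₀ (formComp X μ))‖ ^ 2)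
    (hVconj : ∀ φ : Site (F.P K) 0 → ℝ, (∀ x x' : Site (F.P K) 0, |φ x - φ x'| ≤ r * eta F n K * (Site.tdist x x' : ℝ)) →
      ∀ X : PBond (F.P K) 0 → Matrix (Fin 2) (Fin 2) ℂ,
      RCLike.re ⟪toL2 F K c₀ X, laplaceA F n K h c₀ cB a (DeltaEtaSlot F n K c₀) U₀ (toL2 F K c₀ X)⟫_ℂ
          - (∑ μ : Fin (F.P K).d, ‖DL2 F n K c₀ U₀ (toL2S F K c₀ (formComp X μ))‖ ^ 2) - θV * ‖toL2 F K c₀ X‖ ^ 2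
        ≤ RCLike.re ⟪toL2 F K c₀ (fun b => Real.exp (φ b.src) • X b), laplaceA F n K h c₀ cB a (DeltaEtaSlot F n K c₀) U₀ (toL2 F K c₀ (fun b => (Real.exp (φ b.src))⁻¹ • X b))⟫_ℂ
          - RCLike.re (∑ μ : Fin (F.P K).d, ⟪DL2 F n K c₀ U₀ (toL2S F K c₀ (formComp (fun b => Real.exp (φ b.src) • X b) μ)),
              DL2 F n K c₀ U₀ (toL2S F K c₀ (formComp (fun b => (Real.exp (φ b.src))⁻¹ • X b) μ))⟫_ℂ))
    (hΘ : 0 < ((1 - ε) * γ - ε * CV - 3 * (r ^ 2 * Real.exp (2 * r)) * (1 + 1 / ε) - θV))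
    {CkD CkQ μ' : ℝ} (hCkD : 0 ≤ CkD) (hCkQ : 0 ≤ CkQ) (hrμ : r < μ')
    (hkD : ∀ (b : PBond (F.P K) 0) (Z : Matrix (Fin 2) (Fin 2) ℂ) (bd : PBond (F.P K) 0),
      ‖(toL2 F K c₀).symm (DL2 F n K c₀ U₀ (DstarL2 F n K c₀ U₀ (toL2 F K c₀ (Pi.single b Z))
          - RS F n K h c₀ cB U₀ (DstarL2 F n K c₀ U₀ (toL2 F K c₀ (Pi.single b Z))))) bd‖
        ≤ CkD * Real.exp (-(μ' * (Site.tdist (P := F.P K) (iterBlockOf (K - n) b.src) (iterBlockOf (K - n) bd.src) : ℝ))) * ‖Z‖)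
    (hkQ : ∀ (b : PBond (F.P K) 0) (Z : Matrix (Fin 2) (Fin 2) ℂ) (bd : PBond (F.P K) 0),
      ‖(toL2 F K c₀).symm (LinearMap.adjoint (Qk F n K h c₀ cB U₀) (((a : ℝ) : ℂ) • Qk F n K h c₀ cB U₀ (toL2 F K c₀ (Pi.single b Z)))) bd‖
        ≤ CkQ * Real.exp (-(μ' * (Site.tdist (P := F.P K) (iterBlockOf (K - n) b.src) (iterBlockOf (K - n) bd.src) : ℝ))) * ‖Z‖)
    {AV : ℝ}
    (hvalb : ∀ (X : PBond (F.P K) 0 → Matrix (Fin 2) (Fin 2) ℂ) (z : Site (F.P K) (K - n)), (∀ b, X b ≠ 0 → iterBlockOf (K - n) b.src = z) →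
      ∀ s : ℝ, 0 ≤ s → (∀ b, ‖X b‖ ≤ s) →
      ∀ bd : PBond (F.P K) 0, ‖((toL2 F K c₀).symm (GT F n K h c₀ cB a (DeltaEtaSlot F n K c₀) U₀ (toL2 F K c₀ X))) bd‖ ≤ s * AV * Real.exp (-((min r (1 / 4) / 2) * (Site.tdist (P := F.P K) (iterBlockOf (K - n) bd.src) z : ℝ))))
    (hroom : 2 * (12 * F.L ^ (K - n) + 5) ≤ (F.P K).sitesPerDir 0)
    (hsmall : exists_curved_localGradient.choose * ((48 * ε₀) * (6 * Real.sqrt 2 * Real.sqrt 10 + 6 * Real.sqrt 2)) * Real.exp (51 * (min r (1 / 4) / 2)) ≤ 1 / 2)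
    :
    ∀ (X : PBond (F.P K) 0 → Matrix (Fin 2) (Fin 2) ℂ) (s : ℝ), (∀ b, ‖X b‖ ≤ s) →
      ‖nabla115 (((F.L : ℝ)⁻¹) ^ (K - n)) (bgOfCfg F K U₀)
          (fun q : Bond 3 (periodsT3 F K) => (toL2 F K c₀).symm (GT F n K h c₀ cB a (DeltaEtaSlot F n K c₀) U₀ (toL2 F K c₀ X)) ((bondEquiv F K).symm q))‖
        ≤ ((2 * ((exists_curved_localGradient.choose * (((Real.sqrt 2 * AV) * Real.exp (51 * (min r (1 / 4) / 2))) * (2 + 2 * Real.sqrt 2 * (4 * ε₀ * (3 + 2457 * norm_bgOfCfg_axialT_sub_le.choose)) + (24 * Real.sqrt 10 + 48) * (48 * ε₀) ^ 2) + (Real.sqrt 2 * ((32 * ε₀ * (AV * Real.exp (5 * (min r (1 / 4) / 2)))) + (CkD * Real.sqrt ((((F.P K).d : ℝ) * ((((F.P K).L : ℝ) ^ (F.P K).d) ^ (K - n))) / c₀) * (Real.exp (6 * r) * Real.sqrt (2 * c₀ * (((F.P K).d : ℝ) * ((((F.P K).L : ℝ) ^ (F.P K).d) ^ (K - n)))) /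 ((1 - ε) * γ - ε * CV - 3 * (r ^ 2 * Real.exp (2 * r)) * (1 + 1 / ε) - θV)) * (2 * (1 + 1 / (μ' - r))) ^ 3) + (CkQ * Real.sqrt ((((F.P K).d : ℝ) * ((((F.P K).L : ℝ) ^ (F.P K).d) ^ (K - n))) / c₀) * (Real.exp (6 * r) * Real.sqrt (2 * c₀ * (((F.P K).d : ℝ) * ((((F.P K).L : ℝ) ^ (F.P K).d) ^ (K - n)))) / ((1 - ε) * γ - ε * CV - 3 * (r ^ 2 * Real.exp (2 * r)) * (1 + 1 / ε) - θV)) * (2 * (1 + 1 / (μ' - r))) ^ 3) + 1)) * Real.exp (51 * (min r (1 / 4) / 2))) + 2 * Real.sqrt 2 * (48 * ε₀) * ((Real.sqrt 2 * AV) * Real.exp (51 * (min r (1 / 4) / 2)))))) * (2 * (1 + 1 / (min r (1 / 4) / 2))) ^ 3) * s := by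
  classical
  intro X s hX
  have hk1 : 0 < (min r (1 / 4) / 2) := by have := lt_min hr (by norm_num : (0 : ℝ) < 1 / 4); positivity
  -- `0 ≤ s` is read off `hX` at one bond
  obtain ⟨b₀⟩ : Nonempty (PBond (F.P K) 0) := ⟨⟨Classical.arbitrary _, ⟨0, by rw [T3Family.P_d]; norm_num⟩⟩⟩
  have hs : 0 ≤ s := (norm_nonneg _).trans (hX b₀)
  -- the block-additive reader
  let Φ : (PBond (F.P K) 0 → Matrix (Fin 2) (Fin 2) ℂ) → (Bond 3 (periodsT3 F K) × Fin 3) → Matrix (Fin 2) (Fin 2) ℂ := fun Y qν =>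
    nabla115 (((F.L : ℝ)⁻¹) ^ (K - n)) (bgOfCfg F K U₀)
      (fun q : Bond 3 (periodsT3 F K) => (toL2 F K c₀).symm (GT F n K h c₀ cB a (DeltaEtaSlot F n K c₀) U₀ (toL2 F K c₀ Y)) ((bondEquiv F K).symm q)) qν
  have hΦ : ∀ f : Site (F.P K) (K - n) → PBond (F.P K) 0 → Matrix (Fin 2) (Fin 2) ℂ, Φ (∑ z, f z) = ∑ z, Φ (f z) := by
    intro f
    funext qν
    simp only [Φ, Finset.sum_apply]
    have hlin : (fun q : Bond 3 (periodsT3 F K) => (toL2 F K c₀).symm (GT F n K h c₀ cB a (DeltaEtaSlot F n K c₀) U₀ (toL2 F K c₀ (∑ z, f z))) ((bondEquiv F K).symm q))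
        = ∑ z, fun q : Bond 3 (periodsT3 F K) => (toL2 F K c₀).symm (GT F n K h c₀ cB a (DeltaEtaSlot F n K c₀) U₀ (toL2 F K c₀ (f z))) ((bondEquiv F K).symm q) := by
      funext q
      rw [map_sum, map_sum, map_sum, Finset.sum_apply, Finset.sum_apply]
    rw [hlin, map_sum, Finset.sum_apply]
  -- `0 ≤ C_∇` is read off §2 at the ZERO source (`s := 1`): no sign hypothesis on `A_V` displayed
  have hC : 0 ≤ (2 * ((exists_curved_localGradient.choose * (((Real.sqrt 2 * AV) * Real.exp (51 * (min r (1 / 4) / 2))) * (2 + 2 * Real.sqrt 2 * (4 * ε₀ * (3 + 2457 * norm_bgOfCfg_axialT_sub_le.choose)) + (24 * Real.sqrt 10 + 48) * (48 * ε₀) ^ 2) + (Real.sqrt 2 * ((32 * ε₀ * (AV * Real.exp (5 * (min r (1 / 4) / 2)))) + (CkD * Real.sqrt ((((F.P K).d : ℝ) * ((((F.P K).L : ℝ) ^ (F.P K).d) ^ (K - n))) / c₀) * (Real.exp (6 * r) * Real.sqrt (2 * c₀ * (((F.P K).d : ℝ) * ((((F.P K).L : ℝ) ^ (F.P K).d)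 ^ (K - n)))) / ((1 - ε) * γ - ε * CV - 3 * (r ^ 2 * Real.exp (2 * r)) * (1 + 1 / ε) - θV)) * (2 * (1 + 1 / (μ' - r))) ^ 3) + (CkQ * Real.sqrt ((((F.P K).d : ℝ) * ((((F.P K).L : ℝ) ^ (F.P K).d) ^ (K - n))) / c₀) * (Real.exp (6 * r) * Real.sqrt (2 * c₀ * (((F.P K).d : ℝ) * ((((F.P K).L : ℝ) ^ (F.P K).d) ^ (K - n)))) / ((1 - ε) * γ - ε * CV - 3 * (r ^ 2 * Real.exp (2 * r)) * (1 + 1 / ε) - θV)) * (2 * (1 + 1 / (μ' - r))) ^ 3) + 1)) * Real.exp (51 * (min r (1 / 4) / 2))) + 2 * Real.sqrt 2 * (48 * ε₀) * ((Real.sqrt 2 * AV) * Real.exp (51 * (min r (1 / 4) / 2)))))) := by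
    obtain ⟨z₀⟩ : Nonempty (Site (F.P K) (K - n)) := ⟨iterBlockOf (K - n) b₀.src⟩
    have h0 := norm_nabla115_GT_apply_le_of_blockSupport' F c₀ U₀ hnK hε₀ hε₀1 hreg hp hr hε hε1 hco hVlow hVconj hΘ hCkD hCkQ hrμ hkD hkQ
      (fun _ => 0) z₀ (fun b hb => absurd rfl hb) zero_le_one (fun _ => by rw [norm_zero]; exact zero_le_one)
      (hvalb (fun _ => 0) z₀ (fun b hb => absurd rfl hb) 1 zero_le_one (fun _ => by rw [norm_zero]; exact zero_le_one)) hroom hsmall (bondEquiv F K b₀) 0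
    have hE : 0 < Real.exp (-((min r (1 / 4) / 2) * (Site.tdist (P := F.P K) (iterBlockOf (K - n) ((bondEquiv F K).symm (bondEquiv F K b₀)).src) z₀ : ℝ))) := Real.exp_pos _
    have h1 : 0 * Real.exp (-((min r (1 / 4) / 2) * (Site.tdist (P := F.P K) (iterBlockOf (K - n) ((bondEquiv F K).symm (bondEquiv F K b₀)).src) z₀ : ℝ)))
        ≤ (2 * ((exists_curved_localGradient.choose * (((Real.sqrt 2 * AV) * Real.exp (51 * (min r (1 / 4) / 2))) * (2 + 2 * Real.sqrt 2 * (4 * ε₀ * (3 + 2457 * norm_bgOfCfg_axialT_sub_le.choose)) + (24 * Real.sqrt 10 + 48) * (48 * ε₀) ^ 2) + (Real.sqrt 2 * ((32 * ε₀ * (AV * Real.exp (5 * (min r (1 / 4) / 2)))) + (CkD * Real.sqrt ((((F.P K).d : ℝ) * ((((F.P K).L : ℝ) ^ (F.P K).d) ^ (K - n))) / c₀) * (Real.exp (6 * r) * Real.sqrt (2 * c₀ * (((F.P K).d : ℝ) * ((((F.P K).L : ℝ) ^ (F.P K).d) ^ (K - n)))) / ((1 - ε) * γ - ε * CV - 3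 * (r ^ 2 * Real.exp (2 * r)) * (1 + 1 / ε) - θV)) * (2 * (1 + 1 / (μ' - r))) ^ 3) + (CkQ * Real.sqrt ((((F.P K).d : ℝ) * ((((F.P K).L : ℝ) ^ (F.P K).d) ^ (K - n))) / c₀) * (Real.exp (6 * r) * Real.sqrt (2 * c₀ * (((F.P K).d : ℝ) * ((((F.P K).L : ℝ) ^ (F.P K).d) ^ (K - n)))) / ((1 - ε) * γ - ε * CV - 3 * (r ^ 2 * Real.exp (2 * r)) * (1 + 1 / ε) - θV)) * (2 * (1 + 1 / (μ' - r))) ^ 3) + 1)) * Real.exp (51 * (min r (1 / 4) / 2))) + 2 * Real.sqrt 2 * (48 * ε₀) * ((Real.sqrt 2 * AV) * Real.exp (51 * (min r (1 / 4) / 2)))))) * Real.exp (-((min r (1 / 4) / 2) * (Site.tdist (P := F.P K) (iterBlockOf (K - n) ((bondEquiv F K).symm (bondEquiv F K b₀)).src) z₀ : ℝ))) := by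
      rw [zero_mul]; exact (norm_nonneg _).trans (h0.trans_eq (by rw [one_mul]))
    exact le_of_mul_le_mul_right h1 hE
  -- block-supported letter for `Φ`
  have hblk : ∀ (Y : PBond (F.P K) 0 → Matrix (Fin 2) (Fin 2) ℂ) (z : Site (F.P K) (K - n)), (∀ i, Y i ≠ 0 → iterBlockOf (K - n) i.src = z) →
      ∀ t : ℝ, 0 ≤ t → (∀ i, ‖Y i‖ ≤ t) →
      ∀ qν : Bond 3 (periodsT3 F K) × Fin 3, ‖Φ Y qν‖ ≤ t * (2 * ((exists_curved_localGradient.choose * (((Real.sqrt 2 * AV) * Real.exp (51 * (min r (1 / 4) / 2))) * (2 + 2 * Real.sqrt 2 * (4 * ε₀ * (3 + 2457 * norm_bgOfCfg_axialT_sub_le.choose)) + (24 * Real.sqrt 10 + 48) * (48 * ε₀) ^ 2) + (Real.sqrt 2 * ((32 * ε₀ * (AV * Real.exp (5 * (min r (1 / 4) / 2)))) + (CkD * Real.sqrt ((((F.P K).d : ℝ) * ((((F.P K).L : ℝ) ^ (F.P K).d) ^ (K - n))) / c₀) * (Real.exp (6 * r) * Real.sqrt (2 * c₀ * (((F.P K).d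 : ℝ) * ((((F.P K).L : ℝ) ^ (F.P K).d) ^ (K - n)))) / ((1 - ε) * γ - ε * CV - 3 * (r ^ 2 * Real.exp (2 * r)) * (1 + 1 / ε) - θV)) * (2 * (1 + 1 / (μ' - r))) ^ 3) + (CkQ * Real.sqrt ((((F.P K).d : ℝ) * ((((F.P K).L : ℝ) ^ (F.P K).d) ^ (K - n))) / c₀) * (Real.exp (6 * r) * Real.sqrt (2 * c₀ * (((F.P K).d : ℝ) * ((((F.P K).L : ℝ) ^ (F.P K).d) ^ (K - n)))) / ((1 - ε) * γ - ε * CV - 3 * (r ^ 2 * Real.exp (2 * r)) * (1 + 1 / ε) - θV)) * (2 * (1 + 1 / (μ' - r))) ^ 3) + 1)) * Real.exp (51 * (min r (1 / 4) / 2))) + 2 * Real.sqrt 2 * (48 * ε₀) * ((Real.sqrt 2 * AV) * Real.exp (51 * (min r (1 / 4) / 2)))))) * Real.exp (-((min r (1 / 4) / 2) * (Site.tdist (P := F.P K) (iterBlockOf (K - n) ((bondEquiv F K).symm qν.1).src) z : ℝ))) := by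
    intro Y z hYz t ht hY qν
    obtain ⟨q, ν⟩ := qν
    exact norm_nabla115_GT_apply_le_of_blockSupport' F c₀ U₀ hnK hε₀ hε₀1 hreg hp hr hε hε1 hco hVlow hVconj hΘ hCkD hCkQ hrμ hkD hkQ Y z hYz ht hY
      (hvalb Y z hYz t ht hY) hroom hsmall q ν
  -- weight rate `0`: the flat source letter
  obtain ⟨z₁⟩ : Nonempty (Site (F.P K) (K - n)) := ⟨iterBlockOf (K - n) b₀.src⟩
  have hY0 : ∀ i : PBond (F.P K) 0, ‖X i‖ ≤ s * Real.exp (-(0 * (Site.tdist (P := F.P K) (iterBlockOf (K - n) i.src) z₁ : ℝ))) := fun i => by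
    rw [zero_mul, neg_zero, Real.exp_zero, mul_one]; exact hX i
  have hB : 0 ≤ ((2 * ((exists_curved_localGradient.choose * (((Real.sqrt 2 * AV) * Real.exp (51 * (min r (1 / 4) / 2))) * (2 + 2 * Real.sqrt 2 * (4 * ε₀ * (3 + 2457 * norm_bgOfCfg_axialT_sub_le.choose)) + (24 * Real.sqrt 10 + 48) * (48 * ε₀) ^ 2) + (Real.sqrt 2 * ((32 * ε₀ * (AV * Real.exp (5 * (min r (1 / 4) / 2)))) + (CkD * Real.sqrt ((((F.P K).d : ℝ) * ((((F.P K).L : ℝ) ^ (F.P K).d) ^ (K - n))) / c₀) * (Real.exp (6 * r) * Real.sqrt (2 * c₀ * (((F.P K).d : ℝ) * ((((F.P K).L : ℝ) ^ (F.P K).d) ^ (K - n)))) / ((1 - ε) * γ - ε * CV - 3 * (r ^ 2 * Real.exp (2 * r)) * (1 + 1 / ε) - θV)) * (2 * (1 + 1 / (μ' - r))) ^ 3) + (CkQ * Real.sqrt ((((F.P K).d : ℝ) * ((((F.P K).L : ℝ) ^ (F.P K).d) ^ (K - n))) / c₀) * (Real.exp (6 * r) * Real.sqrt (2 * c₀ *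 (((F.P K).d : ℝ) * ((((F.P K).L : ℝ) ^ (F.P K).d) ^ (K - n)))) / ((1 - ε) * γ - ε * CV - 3 * (r ^ 2 * Real.exp (2 * r)) * (1 + 1 / ε) - θV)) * (2 * (1 + 1 / (μ' - r))) ^ 3) + 1)) * Real.exp (51 * (min r (1 / 4) / 2))) + 2 * Real.sqrt 2 * (48 * ε₀) * ((Real.sqrt 2 * AV) * Real.exp (51 * (min r (1 / 4) / 2)))))) * (2 * (1 + 1 / (min r (1 / 4) / 2))) ^ 3) * s := by positivity
  refine (pi_norm_le_iff_of_nonneg hB).2 fun qν => ?_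
  have hw := weighted_of_blockSupported (F := F) (n := n) (K := K) (fun i : PBond (F.P K) 0 => iterBlockOf (K - n) i.src)
    (fun qν : Bond 3 (periodsT3 F K) × Fin 3 => iterBlockOf (K - n) ((bondEquiv F K).symm qν.1).src) Φ hΦ hC le_rfl hk1 (le_of_eq (zero_add _)) hblk z₁ X s hs hY0 qν
  rw [zero_mul, neg_zero, Real.exp_zero, mul_one] at hw
  exact hw.trans_eq (by ring)

end Summit.QuantumFields.YangMills.Theorems.Prop7OneFormGreenBlockGradient

end
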